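import Summits.ResolutionOfSingularities.ResolutionOfSingularities.Theorems.FrobeniusLadderFInjectiveMacaulayficationBlowupAlgebraLocalization
import Summits.ResolutionOfSingularities.ResolutionOfSingularities.Theorems.FrobeniusLadderFInjectiveMacaulayficationCertifiedCoverCongr
import Summits.ResolutionOfSingularities.ResolutionOfSingularities.Theorems.FrobeniusLadderFInjectiveMacaulayficationClauseOfMaximal
import Literature.AlgebraicGeometry.Resolution.BlowupChartTransition
import Mathlib.Algebra.CharP.Algebra
import HarnessLib

/-!
# T-𝒫 §3a — CERTIFICATES LOCALISE (`certificatesLocalization`)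
# (crux `FInjectiveMacaulayfication` stmt-ResolutionOfSingularities-15315, chain w45a; res-L1-w45a-plan-1 CRUX-PLAN v10 R10.3 /
# `L/w45a/ClassGlueSig.lean` v2 `239444958d057f2d` §3a `stub_certificatesLocalization`, VERBATIM — owner res-D-pv-017 AS res-L1-w45a-stub-5)

Support file for crux stmt-ResolutionOfSingularities-15315 (`FrobeniusLadder.FInjectiveMacaulayfication`), chain w45a.
[OURS · L1 W4.5a] — NOT a statement of any manuscript; AI-written, weaker than expert review.

E6‴ cover certificates for `(R, I, v)` — the Rees charts of the `v_j` cover `Bl_I`, every `v_j ≠ 0`, and every affine blow-up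
algebra `R[I/v_j]` satisfies the Cohen–Macaulay + Frobenius-closed clause at its maximal ideals containing `v_j/1` — give the same
certificates for `(R[1/s], I·R[1/s], v/1)`, `s ≠ 0` (`R` a Noetherian domain of characteristic `p`). Proof: the cover inequality in
SUM FORM (`CertifiedCoverCongr.exists_sum_of_irrelevant_le_radical` / `irrelevant_le_radical_of_sum`) maps along `R → R[1/s]`
(an element of `I·R[1/s]` is `b/sⁿ`, `b ∈ I`); `v_j/1 ≠ 0` by injectivity; and a maximal ideal `Q'` of
`R[1/s][I R[1/s]/v_j] ⊇ R[I/v_j]` contracts to a prime `q ∋ v_j/1` of `R[I/v_j]`, below a maximal `Q ∋ v_j/1` where `hon` holds, so the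
clause descends to `R[I/v_j]_q` (`ClauseOfMaximal.fiClause_atPrime_of_le`, E5) and crosses the isomorphism
`R[I/v_j]_q ≅ R[1/s][I R[1/s]/v_j]_{Q'}` (`BlowupAlgebraLocalization.nonempty_ringEquiv_atPrime_comap`). Used twice by T-𝒫 §4b (chart,
then shrinking). No definitions, no named facts. [folklore]
-/

-- single-problem summit: the doubled namespace component is forced
set_option linter.dupNamespace false

noncomputable section

open Literature.AlgebraicGeometry.Resolution

namespace Summit.ResolutionOfSingularities.ResolutionOfSingularities.Theorems.FInjectiveMacaulayfication.CertificatesLocalization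

open Summit.ResolutionOfSingularities.ResolutionOfSingularities.Theorems.FInjectiveMacaulayfication

/-- **The cover inequality localises**: if the Rees charts of `v₁, …, v_t` cover `Bl_I(R)`, those of `v₁/1, …, v_t/1` cover
`Bl_{I R'}(R')` for any localization `R' = M⁻¹R` (sum form: `b'·(m/1) = b/1`, `bᴺ = Σ v_j y_j` ⇒ `b'ᴺ = Σ (v_j/1)·(y_j/1)(m/1)⁻ᴺ`).
[folklore] -/
theorem reesCover_localization {R R' : Type} [CommRing R] [CommRing R'] [Algebra R R'] (M : Submonoid R) [IsLocalization M R']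
    (I : Ideal R) {t : ℕ} (v : Fin t → R) (hv : ∀ j : Fin t, v j ∈ I)
    (hcov : (HomogeneousIdeal.irrelevant (reesGrading I)).toIdeal ≤
      (Ideal.span (Set.range fun j : Fin t => reesT (I := I) (v j) (hv j))).radical) :
    (HomogeneousIdeal.irrelevant (reesGrading (I.map (algebraMap R R')))).toIdeal ≤
      (Ideal.span (Set.range fun j : Fin t => reesT (I := I.map (algebraMap R R')) (algebraMap R R' (v j))
        (Ideal.mem_map_of_mem (algebraMap R R') (hv j)))).radical := by
  classical
  refine CertifiedCoverCongr.irrelevant_le_radical_of_sum _ _ fun b' hb' => ?_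
  obtain ⟨⟨⟨b, hb⟩, m⟩, hbm⟩ := (IsLocalization.mem_map_algebraMap_iff M R').mp hb'
  obtain ⟨N, hN, y, hy, hsum⟩ := CertifiedCoverCongr.exists_sum_of_irrelevant_le_radical v hv hcov b hb
  have hmU : IsUnit (algebraMap R R' m) := IsLocalization.map_units R' m
  have hb'eq : b' = algebraMap R R' b * ↑(hmU.unit⁻¹) := by
    rw [← hbm, mul_assoc, IsUnit.mul_val_inv, mul_one]
  refine ⟨N, hN, fun j => algebraMap R R' (y j) * ↑(hmU.unit⁻¹) ^ N, fun j => ?_, ?_⟩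
  · refine Ideal.mul_mem_right _ _ ?_
    rw [← Ideal.map_pow]
    exact Ideal.mem_map_of_mem _ (hy j)
  · rw [hb'eq, mul_pow, ← map_pow, hsum, map_sum, Finset.sum_mul]
    refine Finset.sum_congr rfl fun j _ => ?_
    rw [map_mul, mul_assoc]

set_option maxHeartbeats 800000 in
/-- **The chart clause localises**: if every `R[I/v_j]` satisfies the Cohen–Macaulay + Frobenius-closed clause at its maximal
ideals containing `v_j/1` (`R` a Noetherian domain of characteristic `p`, `v_j ≠ 0`), so does `R'[IR'/v_j]` for `R' = M⁻¹R` with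
`R → R'` injective. [folklore] -/
theorem chartClause_localization (p : ℕ) [Fact p.Prime] {R R' : Type} [CommRing R] [IsDomain R] [IsNoetherianRing R] [CharP R p]
    [CommRing R'] [Algebra R R'] (M : Submonoid R) [IsLocalization M R'] (hinj : Function.Injective (algebraMap R R'))
    (I : Ideal R) (a : R) (ha0 : a ≠ 0)
    (hon : ∀ (Q : Ideal (blowupAlgebra I a)) [Q.IsMaximal], algebraMap R (blowupAlgebra I a) a ∈ Q →
      ∀ d : ℕ, ringKrullDim (Localization.AtPrime Q) = d → ∀ s : Fin d → Localization.AtPrime Q,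
        (Ideal.span (Set.range s)).radical.IsMaximal →
          RingTheory.Sequence.IsWeaklyRegular (Localization.AtPrime Q) (List.ofFn s) ∧
          ∀ y : Localization.AtPrime Q, (∃ e : ℕ, y ^ p ^ e ∈ Ideal.span
            ((fun z : Localization.AtPrime Q => z ^ p ^ e) ''
              (Ideal.span (Set.range s) : Set (Localization.AtPrime Q)))) → y ∈ Ideal.span (Set.range s))
    (Q' : Ideal (blowupAlgebra (I.map (algebraMap R R')) (algebraMap R R' a))) [Q'.IsMaximal]
    (hQ' : algebraMap R' (blowupAlgebra (I.map (algebraMap R R')) (algebraMap R R' a)) (algebraMap R R' a) ∈ Q') :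
    ∀ d : ℕ, ringKrullDim (Localization.AtPrime Q') = d → ∀ s : Fin d → Localization.AtPrime Q',
      (Ideal.span (Set.range s)).radical.IsMaximal →
        RingTheory.Sequence.IsWeaklyRegular (Localization.AtPrime Q') (List.ofFn s) ∧
        ∀ y : Localization.AtPrime Q', (∃ e : ℕ, y ^ p ^ e ∈ Ideal.span
          ((fun z : Localization.AtPrime Q' => z ^ p ^ e) ''
            (Ideal.span (Set.range s) : Set (Localization.AtPrime Q')))) → y ∈ Ideal.span (Set.range s) := by
  obtain ⟨ψ, hψ⟩ := BlowupAlgebraLocalization.exists_map I a (algebraMap R R')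
  -- the contracted prime contains `a/1`; put a maximal ideal above it
  have haq : algebraMap R (blowupAlgebra I a) a ∈ Q'.comap ψ := by
    rw [Ideal.mem_comap, BlowupAlgebraLocalization.map_algebraMap hψ]
    exact hQ'
  obtain ⟨Q, hQmax, hqQ⟩ := Ideal.exists_le_maximal (Q'.comap ψ) (Ideal.IsPrime.ne_top inferInstance)
  -- the chart ring `R[I/a]` is a Noetherian domain of characteristic `p`
  haveI : IsDomain (Localization.Away a) := IsLocalization.isDomain_localization (powers_le_nonZeroDivisors_of_noZeroDivisors ha0)
  haveI : IsDomain (blowupAlgebra I a) := Subalgebra.isDomain _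
  haveI : IsNoetherianRing (blowupAlgebra I a) := isNoetherianRing_blowupAlgebra_of_isNoetherianRing I a
  haveI : CharP (Localization.Away a) p :=
    charP_of_injective_algebraMap (IsLocalization.injective (Localization.Away a) (powers_le_nonZeroDivisors_of_noZeroDivisors ha0)) p
  haveI : CharP (blowupAlgebra I a) p := (algebraMap (blowupAlgebra I a) (Localization.Away a)).charP Subtype.val_injective p
  haveI : IsDomain (Localization.AtPrime Q) :=
    IsLocalization.isDomain_localization (M := Q.primeCompl) (Ideal.primeCompl_le_nonZeroDivisors Q)
  -- descend the clause from `Q` to the contracted prime, then cross `R[I/a]_q ≅ R'[IR'/a]_{Q'}`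
  have hq := ClauseOfMaximal.fiClause_atPrime_of_le p hqQ ⟨inferInstance, hon Q (hqQ haq)⟩
  obtain ⟨e⟩ := BlowupAlgebraLocalization.nonempty_ringEquiv_atPrime_comap M hinj I a hψ Q'
  exact DegreeZeroDescent.inlineClause_of_ringEquiv (L' := Localization.AtPrime Q') p e hq.2

/-- **T-𝒫 §3a — CERTIFICATES LOCALISE** (`L/w45a/ClassGlueSig.lean` v2 `239444958d057f2d` `stub_certificatesLocalization`,
VERBATIM): E6‴ cover certificates for `(R, I, v)` over a Noetherian domain `R` of characteristic `p` give E6‴ cover certificates for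
`(R[1/s], I·R[1/s], v/1)` for every `s ≠ 0`. [folklore] -/
theorem certificatesLocalization : ∀ (p : ℕ) [Fact p.Prime] (R : Type) [CommRing R] [IsDomain R] [IsNoetherianRing R]
    [CharP R p] (I : Ideal R) (t : ℕ) (v : Fin t → R) (hv : ∀ j : Fin t, v j ∈ I),
    ((HomogeneousIdeal.irrelevant (reesGrading I)).toIdeal ≤ (Ideal.span (Set.range fun j : Fin t => reesT (I := I) (v j) (hv j))).radical ∧
          (∀ j : Fin t, v j ≠ 0) ∧
          ∀ (j : Fin t) (Q : Ideal (Literature.AlgebraicGeometry.Resolution.blowupAlgebra I (v j))) [Q.IsMaximal],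
            algebraMap R (Literature.AlgebraicGeometry.Resolution.blowupAlgebra I (v j)) (v j) ∈ Q →
            ∀ d : ℕ, ringKrullDim (Localization.AtPrime Q) = d → ∀ s : Fin d → Localization.AtPrime Q, (Ideal.span (Set.range s)).radical.IsMaximal → RingTheory.Sequence.IsWeaklyRegular (Localization.AtPrime Q) (List.ofFn s) ∧ ∀ y : Localization.AtPrime Q, (∃ e : ℕ, y ^ p ^ e ∈ Ideal.span ((fun z : Localization.AtPrime Q => z ^ p ^ e) '' (Ideal.span (Set.range s) : Set (Localization.AtPrime Q)))) → y ∈ Ideal.span (Set.range s)) →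
    ∀ (s : R), s ≠ 0 →
      (HomogeneousIdeal.irrelevant (reesGrading (Ideal.map (algebraMap R (Localization.Away s)) I))).toIdeal ≤ (Ideal.span (Set.range fun j : Fin t => reesT (I := (Ideal.map (algebraMap R (Localization.Away s)) I)) ((fun j : Fin t => algebraMap R (Localization.Away s) (v j)) j) (Ideal.mem_map_of_mem (algebraMap R (Localization.Away s)) (hv j)))).radical ∧
          (∀ j : Fin t, (fun j : Fin t => algebraMap R (Localization.Away s) (v j)) j ≠ 0) ∧
          ∀ (j : Fin t) (Q : Ideal (Literature.AlgebraicGeometry.Resolution.blowupAlgebra (Ideal.map (algebraMap R (Localization.Away s)) I) ((fun j : Fin t => algebraMap R (Localization.Away s) (v j)) j))) [Q.IsMaximal],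
            algebraMap (Localization.Away s) (Literature.AlgebraicGeometry.Resolution.blowupAlgebra (Ideal.map (algebraMap R (Localization.Away s)) I) ((fun j : Fin t => algebraMap R (Localization.Away s) (v j)) j)) ((fun j : Fin t => algebraMap R (Localization.Away s) (v j)) j) ∈ Q →
            ∀ d : ℕ, ringKrullDim (Localization.AtPrime Q) = d → ∀ s : Fin d → Localization.AtPrime Q, (Ideal.span (Set.range s)).radical.IsMaximal → RingTheory.Sequence.IsWeaklyRegular (Localization.AtPrime Q) (List.ofFn s) ∧ ∀ y : Localization.AtPrime Q, (∃ e : ℕ, y ^ p ^ e ∈ Ideal.span ((fun z : Localization.AtPrime Q => z ^ p ^ e) '' (Ideal.span (Set.range s) : Set (Localization.AtPrime Q)))) → y ∈ Ideal.span (Set.range s) := by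
  intro p _ R _ _ _ _ I t v hv hcert s hs
  obtain ⟨hcov, hv0, hon⟩ := hcert
  have hinj : Function.Injective (algebraMap R (Localization.Away s)) :=
    IsLocalization.injective (Localization.Away s) (powers_le_nonZeroDivisors_of_noZeroDivisors hs)
  refine ⟨reesCover_localization (Submonoid.powers s) I v hv hcov, fun j h => hv0 j (hinj (h.trans (map_zero _).symm)), ?_⟩
  intro j Q' _ hQ'
  exact chartClause_localization p (Submonoid.powers s) hinj I (v j) (hv0 j) (fun Q _ hQ => hon j Q hQ) Q' hQ'

end Summit.ResolutionOfSingularities.ResolutionOfSingularities.Theorems.FInjectiveMacaulayfication.CertificatesLocalization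

end
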